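import Literature.IUT.HodgeTheaters.GlobalFrobenioidsCyclotomeRigidity
import Literature.AnabelianGeometry.EtaleTheta.CyclotomeZHatAction
import Literature.AnabelianGeometry.EtaleTheta.ZHatLevelDetermination
import HarnessLib

/-!
# [IUTchI] Example 5.1 (v), p. 127–128: "`ℚ_{>0} ∩ Ẑ^× = {1}`" for the tree's REAL `Ẑ^× = Aut(Ẑ)` and its
# REAL action on cyclotomes

Mochizuki, *Inter-universal Teichmüller theory I*, §5, Example 5.1 (v), kurims manuscript (May 2020)
p. 127 l. 75 – p. 128 l. 24 ([IUTchI] Ex 5.1 (v) pp.127–128) [claim: Mochizuki2012, status: disputed]: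
"it follows immediately, by considering divisors of zeroes and poles [cf. the definition of a
"`κ`-coric function" given in Remark 3.1.7, (i)] associated to Kummer classes of rational functions as
in [AbsTopIII], Proposition 1.6, (iii), from the elementary observation that, relative to the natural
inclusion `ℚ ↪ Ẑ ⊗ ℚ`, `ℚ_{>0} ∩ Ẑ^× = {1}`, that there exists a unique isomorphism of cyclotomes …".

Sub-DAG row E51/L27 (b) of `plan/L5/SUBDAG-IUTchI-Ex51.md`; GAP-LEDGER G-w4d056-2, law (b).  PROOF-ONLY
(theorems, no definition, no new fact); the mathematics is classical (`Ẑ = lim ℤ/nℤ`,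
[RibesZalesskii2010, Thm 2.7.1]).

**What this file adds.**  abc-iut-w5-d110's engine (`GlobalFrobenioidsCyclotomeRigidity.lean`) proves the
observation for COMPATIBLE UNIT EXPONENT SYSTEMS `a : ℕ → ℕ`, the combinatorial shadow of `Aut(μ_Ẑ) = Ẑ^×`.
Meanwhile the tree acquired the REAL objects (`CyclotomeZHatAction.lean`, classical): the level characters
`χ_n : Aut(Ẑ) → ℤ/nℤ` (`ZHatLevel.levelChar`) and the `Ẑ^×`-ACTION `cyclotome.zhatTwist A : Aut(Ẑ) →* Aut(Λ(A))`
on every cyclotome `Λ(A) = lim A[n]`.  Here the two are joined: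
* `levelChar_val_modEq`, `levelChar_val_coprime` — the exponent system `n ↦ χ_n(u).val` of `u ∈ Aut(Ẑ)` is
  compatible and unit, i.e. an admissible input of the engine;
* `levelChar_mul_modEq_of_apply_eta` — a DIVISOR RELATION `u(d) = d′` between integers `d, d′ ∈ ℤ ⊆ Ẑ`
  ("`Ẑ^×` acts on the integer divisors of Kummer classes by multiplication") reads `χ_n(u)·d ≡ d′ (mod n)`
  at every level;
* `eq_or_eq_neg_of_apply_eta` — **`ℚ ∩ Ẑ^× = {±1}`**: if `u ∈ Aut(Ẑ)` carries a nonzero integer `d` to an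
  integer `d′`, then `d′ = ±d`;
* `levelChar_eq_one_of_apply_eta_self` — an element of `Ẑ^×` FIXING a nonzero integer has all `χ_n = 1`;
* `levelChar_eq_one_of_two_zeros_one_pole` — **`ℚ_{>0} ∩ Ẑ^× = {1}` in the printed use**: if `u` carries two
  POSITIVE integers `d₁, d₂` [orders of a `κ`-coric function at two distinct zeroes, Rmk 3.1.7 (i)] to integers
  `d₁′, d₂′` NOT BOTH NEGATIVE [the image function has "precisely one pole"], then `χ_n(u) = 1` for all `n`;
* `zhatTwist_eq_one_of_two_zeros_one_pole` / `zhatTwist_apply_eq_self_of_two_zeros_one_pole` — hence `u`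
  acts as the IDENTITY on EVERY cyclotome `Λ(A)`: the automorphism of `μ_Ẑ(−)` it induces is trivial — the
  form in which the observation is consumed (uniqueness of the cyclotome isomorphism, p. 128; cf. [IUTchII]
  Cor. 1.11 (a) "the `Γ`-orbit, `Γ ⊆ Ẑ^×`").
* v2 (append-only): `eq_one_of_two_zeros_one_pole` / `eq_one_of_apply_eta_self` — with abc-iut-w4-d024's
  `ZHatLevel.eq_of_levelChar_eq` (`Aut(Ẑ)` is determined by its cyclotomic characters) the conclusion becomes the
  literal `u = 1` in `Aut(Ẑ)`.
The (a)-half of G-w4d056-2 (naturality of the Kummer map under automorphisms of the coric pair,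
`κ ∘ e = u • κ`) is an interface item of the Kummer-map merge and is NOT touched here.  No side is taken on
[IUTchIII] Cor. 3.12; nothing of the disputed series is asserted.
-/

namespace Literature.IUT.HodgeTheaters

namespace CyclotomeRigidity

open ProfiniteGrp ProfiniteGrp.ProfiniteCompletion
open Literature.AnabelianGeometry.EtaleTheta Literature.AnabelianGeometry.EtaleTheta.ZHatLevel

variable (u : MulAut (completion (GrpCat.of (Multiplicative ℤ))))

/-! ### The exponent system of an element of `Ẑ^×` is compatible and unit -/

/-- **Compatibility** of the level characters of `u ∈ Aut(Ẑ) = Ẑ^×`: `χ_n(u) ≡ χ_m(u) (mod m)` for `m ∣ n`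
(as natural-number representatives) — the hypothesis `ha` of the exponent-system engine.
([IUTchI] Ex 5.1 (v) p.127) [claim: Mochizuki2012, status: disputed] -/
theorem levelChar_val_modEq (m n : ℕ) (hm : 0 < m) (hn : 0 < n) (hmn : m ∣ n) :
    (levelChar ⟨n, hn⟩ u).val ≡ (levelChar ⟨m, hm⟩ u).val [MOD m] := by
  obtain ⟨k, rfl⟩ := hmn
  have hk : 0 < k := Nat.pos_of_ne_zero fun hk => by simp [hk] at hn
  have h := val_levelChar_mul_mod ⟨m, hm⟩ ⟨k, hk⟩ u
  have hlt : (levelChar ⟨m, hm⟩ u).val < m := ZMod.val_lt _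
  unfold Nat.ModEq
  rw [Nat.mod_eq_of_lt hlt]
  exact h

/-- **Unit property**: `χ_n(u)` is a unit of `ℤ/nℤ` (`χ_n(u)·χ_n(u⁻¹) = 1`), so its representative is prime to
`n` — the hypothesis `hcop` of the engine. ([IUTchI] Ex 5.1 (v) p.127) [claim: Mochizuki2012, status: disputed] -/
theorem levelChar_val_coprime (n : ℕ+) : ((levelChar n u).val).Coprime n := by
  have hu : IsUnit (levelChar n u) := IsUnit.of_mul_eq_one _ (levelChar_mul_levelChar_inv n u)
  obtain ⟨w, hw⟩ := hu
  rw [← hw]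
  exact ZMod.val_coe_unit_coprime w

/-! ### Divisor relations `u(d) = d′` read at finite levels -/

/-- **A divisor relation at every level.**  If `u ∈ Aut(Ẑ)` carries the integer `d ∈ ℤ ⊆ Ẑ` to the integer
`d′` [as when `u · κ(f) = κ(f′)` for rational functions `f`, `f′` with orders `d`, `d′` at a point: "divisors
of zeroes and poles … associated to Kummer classes of rational functions", [AbsTopIII] Prop. 1.6 (iii)], then
`χ_n(u) · d ≡ d′ (mod n)` for every `n ≥ 1`. ([IUTchI] Ex 5.1 (v) p.127) [claim: Mochizuki2012, status: disputed] -/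
theorem levelChar_mul_modEq_of_apply_eta {d d' : ℤ} (h : u (eta d) = eta d') (n : ℕ+) :
    ((levelChar n u).val : ℤ) * d ≡ d' [ZMOD ((n : ℕ) : ℤ)] := by
  haveI : NeZero (n : ℕ) := ⟨n.ne_zero⟩
  have h1 := toAdd_level_aut n u (eta d)
  rw [h, level_eta, level_eta, toAdd_ofAdd, toAdd_ofAdd] at h1
  -- `h1 : (d' : ZMod n) = χ_n(u) * (d : ZMod n)`
  apply (ZMod.intCast_eq_intCast_iff _ _ _).1
  push_cast
  rw [ZMod.natCast_zmod_val]
  exact h1.symm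

/-! ### `ℚ ∩ Ẑ^× = {±1}` -/

/-- **`ℚ ∩ Ẑ^× = {±1}` in `Ẑ`.**  If an element `u` of `Ẑ^× = Aut(Ẑ)` carries a NONZERO integer `d` to an
integer `d′`, then `d′ = d` or `d′ = −d` (abc-iut-w5-d110's `exponents_abs_eq` applied to the exponent system
of `u`). ([IUTchI] Ex 5.1 (v) p.127) [claim: Mochizuki2012, status: disputed] -/
theorem eq_or_eq_neg_of_apply_eta {d d' : ℤ} (hd : d ≠ 0) (h : u (eta d) = eta d') : d' = d ∨ d' = -d :=
  exponents_abs_eq (fun k => if hk : 0 < k then (levelChar ⟨k, hk⟩ u).val else 1)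
    (fun n hn => by simp only [dif_pos hn]; exact levelChar_val_coprime u ⟨n, hn⟩) hd
    (fun n hn => by simp only [dif_pos hn]; exact levelChar_mul_modEq_of_apply_eta u h ⟨n, hn⟩)

/-- **An element of `Ẑ^×` fixing a nonzero integer is trivial at every level**: `u(d) = d`, `d ≠ 0` ⇒
`χ_n(u) = 1` for all `n` (engine: `exponents_trivial_of_fixes`). ([IUTchI] Ex 5.1 (v) p.127)
[claim: Mochizuki2012, status: disputed] -/
theorem levelChar_eq_one_of_apply_eta_self {d : ℤ} (hd : d ≠ 0) (h : u (eta d) = eta d) (n : ℕ+) :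
    levelChar n u = 1 := by
  have key := exponents_trivial_of_fixes (fun k => if hk : 0 < k then (levelChar ⟨k, hk⟩ u).val else 1)
    (fun m k hm hk hmk => by
      simp only [dif_pos hm, dif_pos hk]; exact levelChar_val_modEq u m k hm hk hmk) hd
    (fun k hk => by simp only [dif_pos hk]; exact levelChar_mul_modEq_of_apply_eta u h ⟨k, hk⟩) n n.pos
  simp only [dif_pos n.pos] at key
  haveI : NeZero (n : ℕ) := ⟨n.ne_zero⟩
  calc levelChar n u = (((levelChar n u).val : ℕ) : ZMod n) := (ZMod.natCast_zmod_val _).symm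
    _ = ((1 : ℕ) : ZMod n) := (ZMod.natCast_eq_natCast_iff' _ _ _).2 key
    _ = 1 := Nat.cast_one

/-! ### `ℚ_{>0} ∩ Ẑ^× = {1}`: the printed use (two zeroes, at most one pole) -/

/-- **`ℚ_{>0} ∩ Ẑ^× = {1}` as used on p. 127.**  Let `u ∈ Ẑ^× = Aut(Ẑ)`, `d₁, d₂ > 0` [the orders of a `κ`-coric
rational function `f` at two distinct zeroes — Rmk 3.1.7 (i): "at least two distinct zeroes"] and `d₁′, d₂′ ∈ ℤ`
NOT BOTH negative [the orders of `f′` at the same two points — Rmk 3.1.7 (i): "precisely one pole"], with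
`u(d₁) = d₁′`, `u(d₂) = d₂′` in `Ẑ` [the divisor relations forced by `u · κ(f) = κ(f′)`].  Then `χ_n(u) = 1` for
every `n ≥ 1` (engine: `exponents_trivial_of_two_zeros_one_pole`). ([IUTchI] Ex 5.1 (v) p.127)
[claim: Mochizuki2012, status: disputed] -/
theorem levelChar_eq_one_of_two_zeros_one_pole {d₁ d₂ d₁' d₂' : ℤ} (hd₁ : 0 < d₁) (hd₂ : 0 < d₂)
    (hpole : ¬ (d₁' < 0 ∧ d₂' < 0)) (h₁ : u (eta d₁) = eta d₁') (h₂ : u (eta d₂) = eta d₂') (n : ℕ+) :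
    levelChar n u = 1 := by
  have key := exponents_trivial_of_two_zeros_one_pole
    (fun k => if hk : 0 < k then (levelChar ⟨k, hk⟩ u).val else 1)
    (fun m k hm hk hmk => by
      simp only [dif_pos hm, dif_pos hk]; exact levelChar_val_modEq u m k hm hk hmk)
    (fun k hk => by simp only [dif_pos hk]; exact levelChar_val_coprime u ⟨k, hk⟩) hd₁ hd₂ hpole
    (fun k hk => by simp only [dif_pos hk]; exact levelChar_mul_modEq_of_apply_eta u h₁ ⟨k, hk⟩)
    (fun k hk => by simp only [dif_pos hk]; exact levelChar_mul_modEq_of_apply_eta u h₂ ⟨k, hk⟩) n n.pos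
  simp only [dif_pos n.pos] at key
  haveI : NeZero (n : ℕ) := ⟨n.ne_zero⟩
  calc levelChar n u = (((levelChar n u).val : ℕ) : ZMod n) := (ZMod.natCast_zmod_val _).symm
    _ = ((1 : ℕ) : ZMod n) := (ZMod.natCast_eq_natCast_iff' _ _ _).2 key
    _ = 1 := Nat.cast_one

/-! ### Consequence: `u` acts trivially on every cyclotome -/

/-- If all level characters of `u ∈ Aut(Ẑ)` are `1`, the `Ẑ^×`-action of `u` on any cyclotome `Λ(A) = lim A[n]`
(`cyclotome.zhatTwist`, `(u · ζ)_n = ζ_n ^ χ_n(u)`) is the identity. ([IUTchI] Ex 5.1 (v) p.128)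
[claim: Mochizuki2012, status: disputed] -/
theorem zhatTwist_eq_one_of_levelChar_eq_one (hu : ∀ n : ℕ+, levelChar n u = 1) (A : Type*) [CommGroup A] :
    cyclotome.zhatTwist A u = 1 := by
  apply MulEquiv.ext
  intro ζ
  rw [MulAut.one_apply]
  refine Subtype.ext (funext fun n => ?_)
  rw [cyclotome.zhatTwist_apply_coe, hu n, ZMod.val_one_eq_one_mod,
    ← pow_eq_pow_mod 1 (cyclotome.pow_eq_one ζ n), pow_one]

/-- **The induced automorphism of `μ_Ẑ(−)` is trivial.**  Under the divisor hypotheses of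
`levelChar_eq_one_of_two_zeros_one_pole` ("two zeroes, at most one pole"), `u ∈ Ẑ^×` acts as the IDENTITY on the
cyclotome `Λ(A) = μ_Ẑ`-type object of EVERY commutative group `A` — the form in which "`ℚ_{>0} ∩ Ẑ^× = {1}`"
yields "there exists a UNIQUE isomorphism of cyclotomes `μ^Θ_Ẑ(π₁(†𝒟^⊚)) ⥲ μ_Ẑ(†𝕄^⊛_∞κ)` such that …" (p. 128:
two such isomorphisms differ by a `u ∈ Ẑ^×` subject to these divisor relations).
([IUTchI] Ex 5.1 (v) p.128) [claim: Mochizuki2012, status: disputed] -/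
theorem zhatTwist_eq_one_of_two_zeros_one_pole {d₁ d₂ d₁' d₂' : ℤ} (hd₁ : 0 < d₁) (hd₂ : 0 < d₂)
    (hpole : ¬ (d₁' < 0 ∧ d₂' < 0)) (h₁ : u (eta d₁) = eta d₁') (h₂ : u (eta d₂) = eta d₂')
    (A : Type*) [CommGroup A] : cyclotome.zhatTwist A u = 1 :=
  zhatTwist_eq_one_of_levelChar_eq_one u
    (fun n => levelChar_eq_one_of_two_zeros_one_pole u hd₁ hd₂ hpole h₁ h₂ n) A

/-- Pointwise form: `u · ζ = ζ` for every `ζ ∈ Λ(A)`. ([IUTchI] Ex 5.1 (v) p.128) [claim: Mochizuki2012, status: disputed] -/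
theorem zhatTwist_apply_eq_self_of_two_zeros_one_pole {d₁ d₂ d₁' d₂' : ℤ} (hd₁ : 0 < d₁) (hd₂ : 0 < d₂)
    (hpole : ¬ (d₁' < 0 ∧ d₂' < 0)) (h₁ : u (eta d₁) = eta d₁') (h₂ : u (eta d₂) = eta d₂')
    {A : Type*} [CommGroup A] (ζ : cyclotome A) : cyclotome.zhatTwist A u ζ = ζ := by
  rw [zhatTwist_eq_one_of_two_zeros_one_pole u hd₁ hd₂ hpole h₁ h₂ A, MulAut.one_apply]

/-- The single-fixed-integer form: `u(d) = d` with `d ≠ 0` already forces `u` to act trivially on every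
cyclotome. ([IUTchI] Ex 5.1 (v) p.128) [claim: Mochizuki2012, status: disputed] -/
theorem zhatTwist_eq_one_of_apply_eta_self {d : ℤ} (hd : d ≠ 0) (h : u (eta d) = eta d)
    (A : Type*) [CommGroup A] : cyclotome.zhatTwist A u = 1 :=
  zhatTwist_eq_one_of_levelChar_eq_one u (fun n => levelChar_eq_one_of_apply_eta_self u hd h n) A

/-! ### v2 (append-only): `u = 1` in `Aut(Ẑ)` itself

abc-iut-w4-d024's `ZHatLevelDetermination.lean` (`ZHatLevel.eq_of_levelChar_eq`: `Aut(Ẑ)` is determined by its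
cyclotomic characters) turns "all `χ_n(u) = 1`" into the literal printed conclusion `u = 1`. -/

/-- An automorphism of `Ẑ` all of whose level characters are `1` IS the identity (`Aut(Ẑ) ↪ lim_n (ℤ/nℤ)^×`,
abc-iut-w4-d024's `eq_of_levelChar_eq`). ([IUTchI] Ex 5.1 (v) p.127) [claim: Mochizuki2012, status: disputed] -/
theorem eq_one_of_levelChar_eq_one (hu : ∀ n : ℕ+, levelChar n u = 1) : u = 1 :=
  eq_of_levelChar_eq fun n => by rw [hu n, map_one]

/-- **`ℚ^× ∩ Ẑ^× ∋ u`, `u` fixing a nonzero integer ⇒ `u = 1`**: an element of `Ẑ^× = Aut(Ẑ)` that fixes some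
nonzero integer `d ∈ ℤ ⊆ Ẑ` is the identity. ([IUTchI] Ex 5.1 (v) p.127) [claim: Mochizuki2012, status: disputed] -/
theorem eq_one_of_apply_eta_self {d : ℤ} (hd : d ≠ 0) (h : u (eta d) = eta d) : u = 1 :=
  eq_one_of_levelChar_eq_one u (levelChar_eq_one_of_apply_eta_self u hd h)

/-- **`ℚ_{>0} ∩ Ẑ^× = {1}`, verbatim** ([IUTchI] Ex 5.1 (v) p. 127: "the elementary observation that, relative to
the natural inclusion `ℚ ↪ Ẑ ⊗ ℚ`, `ℚ_{>0} ∩ Ẑ^× = {1}`", in the printed use): an element `u ∈ Ẑ^× = Aut(Ẑ)`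
carrying two POSITIVE integers `d₁, d₂` to integers `d₁′, d₂′` NOT BOTH NEGATIVE [Rmk 3.1.7 (i): "precisely one
pole … but at least two distinct zeroes"] IS the identity of `Ẑ`. ([IUTchI] Ex 5.1 (v) p.127)
[claim: Mochizuki2012, status: disputed] -/
theorem eq_one_of_two_zeros_one_pole {d₁ d₂ d₁' d₂' : ℤ} (hd₁ : 0 < d₁) (hd₂ : 0 < d₂)
    (hpole : ¬ (d₁' < 0 ∧ d₂' < 0)) (h₁ : u (eta d₁) = eta d₁') (h₂ : u (eta d₂) = eta d₂') : u = 1 :=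
  eq_one_of_levelChar_eq_one u fun n => levelChar_eq_one_of_two_zeros_one_pole u hd₁ hd₂ hpole h₁ h₂ n

/-- Consequently, under the same divisor hypotheses, `u` fixes EVERY integer (indeed every element of `Ẑ`) and
`d₁′ = d₁`, `d₂′ = d₂`. ([IUTchI] Ex 5.1 (v) p.127) [claim: Mochizuki2012, status: disputed] -/
theorem apply_eta_eq_of_two_zeros_one_pole {d₁ d₂ d₁' d₂' : ℤ} (hd₁ : 0 < d₁) (hd₂ : 0 < d₂)
    (hpole : ¬ (d₁' < 0 ∧ d₂' < 0)) (h₁ : u (eta d₁) = eta d₁') (h₂ : u (eta d₂) = eta d₂') (d : ℤ) :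
    u (eta d) = eta d := by
  rw [eq_one_of_two_zeros_one_pole u hd₁ hd₂ hpole h₁ h₂, MulAut.one_apply]

end CyclotomeRigidity

end Literature.IUT.HodgeTheaters
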